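import Summits.ResolutionOfSingularities.ResolutionOfSingularities.Theorems.PurelyInseparableDim4TorusEquivarianceCell
import HarnessLib

/-!
# [OURS · res-dim4-pi] A recurrence UP TO SCALING is a non-termination certificate (bisimulation form):
  from `s ⟶⁺ c · s(νx)` an infinite branch is built

Cell `res-dim4-pi` (D-0157 DOOR 2, wave 2), seat `res-dim4-p-6`; sequel of `PurelyInseparableDim4TorusEquivarianceCell`
(`step1h_scale`, `step2_scale`, `stepHP_scale`, `step0_scale`: the step relations of record are SIMULATED by the
torus-and-unit relation) and companion of `PurelyInseparableDim4OrbitRecurrence` (the renaming case, where the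
symmetry is a global map).  Under the torus the symmetry CHANGES chart by chart, so the unrolling needs the
relational (bisimulation) form:

* §1 (pure logic) **`exists_chain_of_transGen_of_bisim`**: if `R a a' → ρ a b → ∃ b', ρ a' b' ∧ R b b'` and there is
  a path `a ⟶⁺ a'` with `R a a'`, then there is an infinite `ρ`-chain from `a` (the set
  `{x | ∃ y, R x y ∧ x ⟶⁺ y}` is forward-invariant along a first step; dependent choice).
* §2 (cell words) with `R s t :⟺ t = (c · s.F(νx), s.r, s.exc)` for units `c, νᵢ`:
  **`exists_branch_of_step1h_transGen_scale`** (+ `Step2`, `StepHP`, `Step0`), hence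
  **`not_terminates1h_of_transGen_scale`**: a MODE-1h path from a state to one of its unit rescalings, over ONE
  field of characteristic `p`, refutes `Terminates1h p q` — the engines' «`S₄ × scalings` reduced» recurrence
  detection is a valid kill for the relations of record.

Scope (honest): relations with all ties; nothing about a particular rule.  [OURS · counted 0 · elementary ·
AI kernel work, weaker than expert review.]  NOTHING here is a statement about resolution of singularities;
resolution in dimension `≥ 4` / characteristic `p > 0` is NOT proved by anything in this file.
bears_on: LADDER-RESOLUTION:D157-DOOR2 (res-dim4-pi · EQUIVARIANCE).  Host item (DR-157-C): `stmt-ResolutionOfSingularities-16155`.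
-/

noncomputable section

set_option linter.dupNamespace false -- mandated namespace of this single-conjunct summit

open MvPolynomial

namespace Summit.ResolutionOfSingularities.ResolutionOfSingularities.Theorems.PIDim4

namespace Torus

/-! ## §1 Unrolling along a bisimulation -/

section Unroll

variable {α : Type*} (ρ R : α → α → Prop)

/-- **Unrolling along a bisimulation**: if `R`-related points have `R`-related `ρ`-successors and there is a path
`a ⟶⁺ a'` to an `R`-related point, then there is an infinite `ρ`-chain from `a`. [folklore] -/
theorem exists_chain_of_transGen_of_bisim (hsim : ∀ a a' b, R a a' → ρ a b → ∃ b', ρ a' b' ∧ R b b')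
    {a a' : α} (hR : R a a') (h : Relation.TransGen ρ a a') :
    ∃ c : ℕ → α, c 0 = a ∧ ∀ m, ρ (c m) (c (m + 1)) := by
  -- `Q x` := `x` reaches an `R`-related point; it propagates to some `ρ`-successor of `x`
  have key : ∀ x, (∃ y, R x y ∧ Relation.TransGen ρ x y) →
      ∃ x₁, ρ x x₁ ∧ ∃ y₁, R x₁ y₁ ∧ Relation.TransGen ρ x₁ y₁ := by
    rintro x ⟨y, hxy, hpath⟩
    obtain ⟨x₁, hx₁, hrest⟩ := Relation.TransGen.head'_iff.mp hpath
    obtain ⟨y₁, hy₁, hR₁⟩ := hsim x y x₁ hxy hx₁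
    exact ⟨x₁, hx₁, y₁, hR₁, Relation.TransGen.tail' hrest hy₁⟩
  let Q : α → Prop := fun x => ∃ y, R x y ∧ Relation.TransGen ρ x y
  let f : {x // Q x} → {x // Q x} := fun x =>
    ⟨Classical.choose (key x.1 x.2), (Classical.choose_spec (key x.1 x.2)).2⟩
  have hf : ∀ x : {x // Q x}, ρ x.1 (f x).1 := fun x => (Classical.choose_spec (key x.1 x.2)).1
  refine ⟨fun m => (f^[m] ⟨a, a', hR, h⟩).1, rfl, fun m => ?_⟩
  show ρ (f^[m] ⟨a, a', hR, h⟩).1 (f^[m + 1] ⟨a, a', hR, h⟩).1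
  rw [Function.iterate_succ_apply']
  exact hf _

end Unroll

/-! ## §2 Cell words: recurrence up to a unit rescaling refutes the termination frames -/

section Cell

variable {K : Type} [Field K] [DecidableEq K]

/-- **A MODE-1h path from a state to one of its unit rescalings `(c · F(νx), r, exc)` unrolls into an infinite
MODE-1h branch.** [folklore] -/
theorem exists_branch_of_step1h_transGen_scale {q : ℕ} {s : State K} {c : K} (hc : c ≠ 0) {ν : Fin 4 → K}
    (hν : ∀ i, ν i ≠ 0)
    (h : Relation.TransGen (Step1h q) s ⟨C c * aeval (fun i => C (ν i) * X i) s.F, s.r, s.exc⟩) :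
    ∃ b : ℕ → State K, b 0 = s ∧ ∀ m, Step1h q (b m) (b (m + 1)) := by
  refine exists_chain_of_transGen_of_bisim (Step1h q)
    (fun s t => ∃ (c : K) (ν : Fin 4 → K), c ≠ 0 ∧ (∀ i, ν i ≠ 0) ∧
      t = ⟨C c * aeval (fun i => C (ν i) * X i) s.F, s.r, s.exc⟩)
    (fun a a' b ⟨c, ν, hc, hν, ha'⟩ hab => ?_) ⟨c, ν, hc, hν, rfl⟩ h
  obtain ⟨c', μ, hc', hμ, hstep⟩ := step1h_scale hc hν hab
  exact ⟨_, ha' ▸ hstep, c', μ, hc', hμ, rfl⟩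

/-- The same for MODE 2. [folklore] -/
theorem exists_branch_of_step2_transGen_scale {q : ℕ} {s : State K} {c : K} (hc : c ≠ 0) {ν : Fin 4 → K}
    (hν : ∀ i, ν i ≠ 0)
    (h : Relation.TransGen (Step2 q) s ⟨C c * aeval (fun i => C (ν i) * X i) s.F, s.r, s.exc⟩) :
    ∃ b : ℕ → State K, b 0 = s ∧ ∀ m, Step2 q (b m) (b (m + 1)) := by
  refine exists_chain_of_transGen_of_bisim (Step2 q)
    (fun s t => ∃ (c : K) (ν : Fin 4 → K), c ≠ 0 ∧ (∀ i, ν i ≠ 0) ∧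
      t = ⟨C c * aeval (fun i => C (ν i) * X i) s.F, s.r, s.exc⟩)
    (fun a a' b ⟨c, ν, hc, hν, ha'⟩ hab => ?_) ⟨c, ν, hc, hν, rfl⟩ h
  obtain ⟨c', μ, hc', hμ, hstep⟩ := step2_scale hc hν hab
  exact ⟨_, ha' ▸ hstep, c', μ, hc', hμ, rfl⟩

/-- The same for HP-permissible steps. [folklore] -/
theorem exists_branch_of_stepHP_transGen_scale {q : ℕ} {s : State K} {c : K} (hc : c ≠ 0) {ν : Fin 4 → K}
    (hν : ∀ i, ν i ≠ 0)
    (h : Relation.TransGen (StepHP q) s ⟨C c * aeval (fun i => C (ν i) * X i) s.F, s.r, s.exc⟩) :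
    ∃ b : ℕ → State K, b 0 = s ∧ ∀ m, StepHP q (b m) (b (m + 1)) := by
  refine exists_chain_of_transGen_of_bisim (StepHP q)
    (fun s t => ∃ (c : K) (ν : Fin 4 → K), c ≠ 0 ∧ (∀ i, ν i ≠ 0) ∧
      t = ⟨C c * aeval (fun i => C (ν i) * X i) s.F, s.r, s.exc⟩)
    (fun a a' b ⟨c, ν, hc, hν, ha'⟩ hab => ?_) ⟨c, ν, hc, hν, rfl⟩ h
  obtain ⟨c', μ, hc', hμ, hstep⟩ := stepHP_scale hc hν hab
  exact ⟨_, ha' ▸ hstep, c', μ, hc', hμ, rfl⟩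

/-- The same for MODE 0. [folklore] -/
theorem exists_branch_of_step0_transGen_scale {q : ℕ} {s : State K} {c : K} (hc : c ≠ 0) {ν : Fin 4 → K}
    (hν : ∀ i, ν i ≠ 0)
    (h : Relation.TransGen (Step0 q) s ⟨C c * aeval (fun i => C (ν i) * X i) s.F, s.r, s.exc⟩) :
    ∃ b : ℕ → State K, b 0 = s ∧ ∀ m, Step0 q (b m) (b (m + 1)) := by
  refine exists_chain_of_transGen_of_bisim (Step0 q)
    (fun s t => ∃ (c : K) (ν : Fin 4 → K), c ≠ 0 ∧ (∀ i, ν i ≠ 0) ∧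
      t = ⟨C c * aeval (fun i => C (ν i) * X i) s.F, s.r, s.exc⟩)
    (fun a a' b ⟨c, ν, hc, hν, ha'⟩ hab => ?_) ⟨c, ν, hc, hν, rfl⟩ h
  obtain ⟨c', μ, hc', hμ, hstep⟩ := step0_scale hc hν hab
  exact ⟨_, ha' ▸ hstep, c', μ, hc', hμ, rfl⟩

/-- **A recurrence up to a unit rescaling kills `Terminates1h`** (one field of characteristic `p`). [folklore] -/
theorem not_terminates1h_of_transGen_scale {p q : ℕ} [CharP K p] {s : State K} {c : K} (hc : c ≠ 0)
    {ν : Fin 4 → K} (hν : ∀ i, ν i ≠ 0)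
    (h : Relation.TransGen (Step1h q) s ⟨C c * aeval (fun i => C (ν i) * X i) s.F, s.r, s.exc⟩) :
    ¬ Terminates1h p q := fun hT => by
  obtain ⟨b, -, hb⟩ := exists_branch_of_step1h_transGen_scale hc hν h
  exact hT K ⟨b, hb⟩

end Cell

end Torus

end Summit.ResolutionOfSingularities.ResolutionOfSingularities.Theorems.PIDim4

end
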